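import Literature.NumberTheory.Automorphic.FontaineMazurGL2WeightOne
import HarnessLib

/-!
# F3 `_special` — the floor `θ = 0` IS the family member (line `CGWeightOneLiftingSplitTR`, crux
# `ReciprocityUpToIrreducibility`, item stmt-Langlands-14328; G4 ladder-down generation 34)

Self-contained certificate (same declarations as sections 1–3 of `Lines/CGWeightOneLiftingSplitTR.lean`):

* the graded family `CGWeightOneLifting : ℕ → Prop` of the BASE-FIELD dial of the Calegari–Geraghty weight-one
  lifting theorem for `GL₂` (`ρ` unramified above `p`, NO `p`-distinguishedness) — `θ = 0`: over `ℚ`; `θ = 1`: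
  totally real `F`, odd `p` split completely (THE RUNG `CGWeightOneLiftingSplitTR`); `θ ≥ 2`: all totally real
  `F`, all odd `p`;
* `floor_zero : Calegari2018Floor → CGWeightOneLifting 0` — PROVED, no `sorry`: the floor cell IS Calegari 2018
  Thm. 1.1 (`Calegari2018Floor` = the statement of the named fact
  `Literature.NumberTheory.Automorphic.Calegari2018_weightOneLifting_unramifiedAtP` VERBATIM — vendored this
  generation to `Literature/NumberTheory/Automorphic/WeightOneLiftingUnramifiedAtP.lean`; the copy keeps this
  certificate independent of the proposal), the added residual-automorphy hypothesis being unused over `ℚ`;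
* `mono : θ ≤ θ' → CGWeightOneLifting θ' → CGWeightOneLifting θ` (in particular rung ⇒ floor cell,
  `rat_of_splitTR`, using `primeSplitsCompletely_rat`: every prime splits completely in `ℚ`);
* `rung_iff_family_one : CGWeightOneLiftingSplitTR ↔ CGWeightOneLifting 1`.

Why the witness lies outside S's known regime and exercises the lever: it is the `θ = 0` member of the SAME typed
family whose `θ = 1` member is open (Deo–Dimitrov–Wiese, arXiv:1911.11196 pp. 3–4: over totally real `F` of
degree `d ≥ 2` only `R ↠ 𝕋^{(1)}`, "a first step towards an `R = 𝕋` theorem"); the floor is proved by exactly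
the lever the rung asks to extend (Calegari–Geraghty patching of coherent weight-one cohomology, `l₀ = 1`), in
the irregular-weight regime where S is not known by any other method without `p`-distinguishedness.
-/

noncomputable section

set_option linter.dupNamespace false

open scoped MatrixGroups Matrix NumberField Classical
open NumberField IsDedekindDomain Field Filter
open Literature.NumberTheory.Automorphic Literature.NumberTheory.GaloisRepresentations
open Literature.NumberTheory.PAdicHodge

namespace Summit.Langlands.Langlands.Cruxes.ReciprocityUpToIrreducibility.CGWeightOneLiftingSplitTR

/-! ## 1. The clauses -/

/-- **`p` splits completely in `F`**: `p ∤ d_F` and every place `v ∣ p` has residue field `𝔽_p` — the two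
clauses of the tree's fact `Tung2021_hilbertTotallySplit` verbatim.  Equivalently `F_v = ℚ_p` for all `v ∣ p`.
[cite: Tung2021, Thm. 4.5] -/
def PrimeSplitsCompletely (F : Type) [Field F] [NumberField F] (p : ℕ) : Prop :=
  ¬ ((p : ℤ) ∣ NumberField.discr F) ∧
    ∀ v : HeightOneSpectrum (𝓞 F), ((p : ℕ) : 𝓞 F) ∈ v.asIdeal → v.residueCard = p

/-- **`ρ̄` is automorphic** (the residual-automorphy clause of `Tung2021_hilbertTotallySplit` /
`BLGGT2014_thm421_GL2_totallyReal` verbatim): some `ρ₀ ≡ ρ (mod 𝔪)` (trace congruence) is attached at almost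
all places, through `ι`, to a cuspidal `π₀` of `GL₂(𝔸_F)` that is `L`-algebraic with a REGULAR infinity type
(a Hilbert eigenform of cohomological weight).  Over `F = ℚ` this follows from the other hypotheses by Serre's
conjecture (Khare–Wintenberger); over `F ≠ ℚ` it is the lifting theorem's input. -/
def ResiduallyAutomorphic (F : Type) [Field F] [NumberField F] (p : ℕ) [Fact p.Prime]
    (hcpt : isCompact_glFiniteIntegralLevel 2 F) (ι : PadicAlgCl p ≃+* ℂ)
    (ρ : FramedGaloisRep F (PadicAlgCl p) 2) : Prop :=
  ∃ (π₀ : CuspidalAutomorphicRepData 2 F hcpt) (ρ₀ : FramedGaloisRep F (PadicAlgCl p) 2),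
    π₀.1.IsLAlgebraic ∧ (∃ T : InfinityType F 2, π₀.1.HasInfinityType T ∧ T.IsRegular) ∧
    SatakeFrobCompatibleAE ι π₀.1 ρ₀ ∧ ∀ σ, ‖(ρ σ).val.trace - (ρ₀ σ).val.trace‖ < 1

/-- **The Calegari–Geraghty weight-one lifting statement at `(F, p, hcpt, ι, ρ)`** — Calegari 2018 Thm. 1.1
transported verbatim from `ℚ` to `F`, plus residual automorphy: for `ρ : Γ_F → GL₂(ℚ̄_p)` continuous, ramified
at finitely many places, UNRAMIFIED AT EVERY `v ∣ p` (no distinguishedness, no genericity), irreducible,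
TOTALLY ODD, with `ρ̄` absolutely irreducible, such that `ρ|Γ_{F_v}` is REDUCIBLE at every ramified `v ∤ p`
("if `ρ` is ramified at a prime `ℓ`, assume that `ρ|D_ℓ` is reducible"), and residually automorphic, there is an
`L`-algebraic cuspidal `π` of `GL₂(𝔸_F)` attached to `ρ` at almost all places (expected: a parallel-weight-one
Hilbert eigenform; Rogawski–Tunnell).
[cite: Calegari2018NonMinimalWeightOne, Thm. 1.1] [cite: CalegariGeraghty2017, Cor. 1.4] -/
def LiftsAt (F : Type) [Field F] [NumberField F] (p : ℕ) [Fact p.Prime]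
    (hcpt : isCompact_glFiniteIntegralLevel 2 F) (ι : PadicAlgCl p ≃+* ℂ)
    (ρ : FramedGaloisRep F (PadicAlgCl p) 2) : Prop :=
  (∀ᶠ v : HeightOneSpectrum (𝓞 F) in cofinite, ρ.IsUnramifiedAt v) →
  (∀ v : HeightOneSpectrum (𝓞 F), ((p : ℕ) : 𝓞 F) ∈ v.asIdeal → ρ.IsUnramifiedAt v) →
  ρ.toGaloisRep.IsIrreducible → ρ.IsOdd → ρ.IsResiduallyAbsIrreducible →
  (∀ v : HeightOneSpectrum (𝓞 F), ((p : ℕ) : 𝓞 F) ∉ v.asIdeal → ¬ ρ.IsUnramifiedAt v →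
      ¬ (ρ.toLocal v).toGaloisRep.IsIrreducible) →
  ResiduallyAutomorphic F p hcpt ι ρ →
  ∃ π : CuspidalAutomorphicRepData 2 F hcpt, π.1.IsLAlgebraic ∧ SatakeFrobCompatibleAE ι π.1 ρ

/-! ## 2. The family graded by the base-field dial `θ` -/

/-- **Cell `θ = 0`** — `F = ℚ` (the FLOOR cell; Calegari's theorem with the residual-automorphy hypothesis added,
which over `ℚ` is redundant). -/
def CGWeightOneLiftingQ : Prop :=
  ∀ (p : ℕ) [Fact p.Prime], p ≠ 2 →
    ∀ (hcpt : isCompact_glFiniteIntegralLevel 2 ℚ) (ι : PadicAlgCl p ≃+* ℂ)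
      (ρ : FramedGaloisRep ℚ (PadicAlgCl p) 2), LiftsAt ℚ p hcpt ι ρ

/-- **THE RUNG `θ = 1`** — Calegari–Geraghty weight-one lifting for `GL₂` over TOTALLY REAL `F` at an odd prime
`p` SPLIT COMPLETELY in `F` (`F_v = ℚ_p` at every `v ∣ p`; Grossi's higher Hida theory is available exactly
here).  OPEN (Deo–Dimitrov–Wiese: "a first step towards an `R = 𝕋` theorem"). -/
def CGWeightOneLiftingSplitTR : Prop :=
  ∀ (F : Type) [Field F] [NumberField F], IsTotallyReal F → ∀ (p : ℕ) [Fact p.Prime], p ≠ 2 →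
    PrimeSplitsCompletely F p →
    ∀ (hcpt : isCompact_glFiniteIntegralLevel 2 F) (ι : PadicAlgCl p ≃+* ℂ)
      (ρ : FramedGaloisRep F (PadicAlgCl p) 2), LiftsAt F p hcpt ι ρ

/-- **Cell `θ ≥ 2`** — every totally real `F`, every odd `p` (no splitting condition).  OPEN; not a stub of
this line. -/
def CGWeightOneLiftingTR : Prop :=
  ∀ (F : Type) [Field F] [NumberField F], IsTotallyReal F → ∀ (p : ℕ) [Fact p.Prime], p ≠ 2 →
    ∀ (hcpt : isCompact_glFiniteIntegralLevel 2 F) (ι : PadicAlgCl p ≃+* ℂ)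
      (ρ : FramedGaloisRep F (PadicAlgCl p) 2), LiftsAt F p hcpt ι ρ

/-- **The rung family** `E(θ)`: `E(0)` = over `ℚ` (floor, in print), `E(1)` = totally real with `p` split
completely (THE RUNG), `E(θ)` for `θ ≥ 2` = all totally real fields and odd primes.
[cite: Calegari2018NonMinimalWeightOne, Thm. 1.1] -/
def CGWeightOneLifting : ℕ → Prop
  | 0 => CGWeightOneLiftingQ
  | 1 => CGWeightOneLiftingSplitTR
  | _ => CGWeightOneLiftingTR

theorem family_zero : CGWeightOneLifting 0 = CGWeightOneLiftingQ := rfl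

theorem family_one : CGWeightOneLifting 1 = CGWeightOneLiftingSplitTR := rfl

theorem family_of_two_le {θ : ℕ} (h : 2 ≤ θ) : CGWeightOneLifting θ = CGWeightOneLiftingTR := by
  match θ, h with
  | (k + 2), _ => rfl

/-! ## 3. Dial monotonicity and the floor -/

/-- Every prime splits completely in `ℚ`: `d_ℚ = 1` (Mathlib `Rat.numberField_discr`) and a place `v ∋ p` of
`ℚ` has `q_v ∣ N((p)) = p` (Mathlib `Ideal.absNorm_dvd_absNorm_of_le`, `Algebra.norm_algebraMap`), so
`q_v = p`. [folklore] -/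
theorem primeSplitsCompletely_rat (p : ℕ) [hp : Fact p.Prime] : PrimeSplitsCompletely ℚ p := by
  refine ⟨?_, fun v hv => ?_⟩
  · rw [Rat.numberField_discr]
    intro h
    have h1 : (p : ℤ) ≤ 1 := Int.le_of_dvd one_pos h
    have h2 : 1 < p := hp.out.one_lt
    omega
  · have h1 : Ideal.absNorm v.asIdeal ∣ Ideal.absNorm (Ideal.span {((p : ℕ) : 𝓞 ℚ)}) :=
      Ideal.absNorm_dvd_absNorm_of_le ((Ideal.span_singleton_le_iff_mem _).mpr hv)
    rw [Ideal.absNorm_span_singleton, show ((p : ℕ) : 𝓞 ℚ) = algebraMap ℤ (𝓞 ℚ) (p : ℤ) by simp,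
      Algebra.norm_algebraMap, NumberField.RingOfIntegers.rank, Module.finrank_self, pow_one,
      Int.natAbs_natCast] at h1
    exact ((Nat.dvd_prime hp.out).mp h1).resolve_left v.one_lt_residueCard.ne'

/-- Dial monotonicity `θ ≥ 2 ⇒ θ = 1`: drop the splitting hypothesis. -/
theorem splitTR_of_TR (h : CGWeightOneLiftingTR) : CGWeightOneLiftingSplitTR :=
  fun F _ _ hF p _ hp _ hcpt ι ρ => h F hF p hp hcpt ι ρ

/-- Dial monotonicity `θ = 1 ⇒ θ = 0`: `ℚ` is totally real and every prime splits completely in it. -/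
theorem rat_of_splitTR (h : CGWeightOneLiftingSplitTR) : CGWeightOneLiftingQ :=
  fun p _ hp hcpt ι ρ => h ℚ inferInstance p hp (primeSplitsCompletely_rat p) hcpt ι ρ

/-- The family is monotone in the dial. -/
theorem mono {θ θ' : ℕ} (hle : θ ≤ θ') (h : CGWeightOneLifting θ') : CGWeightOneLifting θ := by
  rcases Nat.lt_or_ge θ' 2 with hθ' | hθ'
  · interval_cases θ' <;> interval_cases θ
    · exact h
    · exact rat_of_splitTR h
    · exact h
  · rw [family_of_two_le hθ'] at h
    rcases Nat.lt_or_ge θ 2 with hθ | hθ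
    · interval_cases θ
      · exact rat_of_splitTR (splitTR_of_TR h)
      · exact splitTR_of_TR h
    · rw [family_of_two_le hθ]; exact h

/-- **The floor fact, verbatim** — the statement of the named fact
`Literature.NumberTheory.Automorphic.Calegari2018_weightOneLifting_unramifiedAtP` (Calegari, J. reine angew.
Math. 740 (2018) Thm. 1.1, rendered in the summit's vocabulary: conclusion = an `L`-algebraic cuspidal `π` of
`GL₂(𝔸_ℚ)` with Satake–Frobenius matching a.e.), copied here so that this skeleton elaborates independently of
the fact file (proposed to `Literature/NumberTheory/Automorphic/WeightOneLiftingUnramifiedAtP.lean` this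
generation).  [cite: Calegari2018NonMinimalWeightOne, Thm. 1.1] -/
def Calegari2018Floor : Prop :=
  ∀ (p : ℕ) [Fact p.Prime], p ≠ 2 →
    ∀ (ρ : FramedGaloisRep ℚ (PadicAlgCl p) 2),
      (∀ᶠ v : HeightOneSpectrum (𝓞 ℚ) in cofinite, ρ.IsUnramifiedAt v) →
      (∀ v : HeightOneSpectrum (𝓞 ℚ), ((p : ℕ) : 𝓞 ℚ) ∈ v.asIdeal → ρ.IsUnramifiedAt v) →
      ρ.toGaloisRep.IsIrreducible → ρ.IsOdd → ρ.IsResiduallyAbsIrreducible →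
      (∀ v : HeightOneSpectrum (𝓞 ℚ), ((p : ℕ) : 𝓞 ℚ) ∉ v.asIdeal → ¬ ρ.IsUnramifiedAt v →
          ¬ (ρ.toLocal v).toGaloisRep.IsIrreducible) →
      ∀ (hcpt : isCompact_glFiniteIntegralLevel 2 ℚ) (ι : PadicAlgCl p ≃+* ℂ),
        ∃ π : CuspidalAutomorphicRepData 2 ℚ hcpt, π.1.IsLAlgebraic ∧ SatakeFrobCompatibleAE ι π.1 ρ

/-- **FLOOR (F3)**: Calegari 2018 Thm. 1.1 (the named fact, verbatim) gives the cell `θ = 0` (the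
residual-automorphy hypothesis is simply not used over `ℚ`). [cite: Calegari2018NonMinimalWeightOne, Thm. 1.1] -/
theorem floor_zero (h : Calegari2018Floor) : CGWeightOneLifting 0 := by
  show CGWeightOneLiftingQ
  intro p _ hp hcpt ι ρ hunr hunrp hirr hodd hres hred _haut
  exact h p hp ρ hunr hunrp hirr hodd hres hred hcpt ι

example (h : Calegari2018Floor) : CGWeightOneLifting 0 := by simpa using floor_zero h

/-- The rung is the family at `θ = 1`. -/
theorem rung_iff_family_one : CGWeightOneLiftingSplitTR ↔ CGWeightOneLifting 1 := Iff.rfl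

end Summit.Langlands.Langlands.Cruxes.ReciprocityUpToIrreducibility.CGWeightOneLiftingSplitTR

end
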